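import Literature.Computability.AlgebraicComplexity.FSV18Thm48TopFanInHolds
import HarnessLib

/-!
# FSV 2018 Cor. 49 (= ToC Cor. 5.25) AS TYPED — the named fact `FSV2018_cor49` DISCHARGED
# ([ASSS16] §4 for the WHOLE class `occurClass D k s`: the level recursion run with the actual
# recursion values, the top-fan-in reduction by the shift `α + e_i` supplied by the SV block)

Forbes–Shpilka–Volk [ForbesShpilkaVolk2018], Cor. 49 (seq.; = ToC Cor. 5.25, p. 30): "For
`D, k = O(1)`, Construction 46 is a `poly(log s, n)`-`ΣΠΣ` succinct generator for the class of
polynomials computed by size-`s` depth-`D` occur-`k` formulas." The tree types its hitting half as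
the named fact `FSV2018_cor49` (`FSV18SuccinctGenerators.lean`): `G^{ASSS} = asssGenCoeff D k n s`
(`D - 2` succinct rank-condenser blocks `G^{RC}_{n,R}`, `R = asssR k D = (2k)^{2D·2^D}`, plus the
shifted SV block `G^{SV'}_{n, R⌈log s⌉ + R⌈log R⌉}`) is a hitting-set generator for
`occurClass F (multilinearMonomials n) D k s`, assuming `char(𝔽) = 0` or `char(𝔽) > s^R` (the
clause FSV inherit verbatim from their Thm. 48). In print Cor. 49 is "immediate from Theorem 48"
(`FSV2018_cor49_of_thm48`, `FSV18OccurReductions.lean`), but FSV's Thm. 48 (`FSV2018_thm48`, an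
abstract sparse-hitting block `Φ`, unbounded top fan-in) is not literally what [ASSS16] §4 prove
(provenance caveat B21/B23 in that fact's docstring): Agrawal–Saha–Saptharishi–Saxena
[AgrawalEtAl2011, §4] build the faithful map only after the reduction "assume that `C` … has a `+`
gate on top having top fanin at most `k`" and reach general top fan-in by the hitting-SET step
`ℋ ⊇ ℋ̃ ∪ {α + e_i}` (arXiv:1111.0582 p0009:L3–L22). The val-lit N1 push therefore discharged the
reduced-class statement `FSV2018_thm48_topFanIn` (`FSV18Thm48TopFanInHolds.lean`) and the occur
bullet of Thm. 9 in a safe reading, leaving `FSV2018_cor49` AS TYPED open: the black-box route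
"`FSV2018_thm48_topFanIn` at `(D+1, 2k, (s+2)², 2k)` + one more SV block" needs the CLOSED FORM
`R' = (4k)^{2(D+1)·2^{D+1}}` seeds / sparsity budget / characteristic threshold, which exceed Cor. 49's
`R = (2k)^{2D·2^D}` (memo HOME/np/p1g3-THM48-provenance-and-plan.md §6, §8.5).

THIS FILE closes that gap and proves `FSV2018_cor49` exactly as typed. The point is that the
closed form is only an upper bound: the printed recursion `r_2 = t`, `r_{ℓ+1} = (c_ℓ+1)2^{c_ℓ+1}k r_ℓ²`
started at `t = 2k` stays below `(2k)^{2^{D+1}} ≤ R = (2k)^{2D·2^D}` at every level the FSV model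
uses, so Cor. 49's own resources (`R` seeds per block, `2^{R⌈log s⌉+R⌈log R⌉ - 1}` sparsity from all
but one SV block, threshold `s^R`) suffice with room to spare; and the top-fan-in reduction needs no
extra DEPTH when it is phrased, as [ASSS16] phrase it, through FAITHFULNESS to the family
`{T_i(X + e_{m₀})}_{i ∋ m₀} ∪ {T_i}_{i ∋ m₀}` of the `≤ 2k` children touched by the shift (each an
occur-`k` formula of depth `≤ D-1` and size `≤ s²`), the signs of `C̃ = Σ_i (T_i(X+e_{m₀}) − T_i)` living
in the polynomial `H = Σ X_i − Σ X'_i` rather than in a formula (`FSV18OccurUnitDifference.lean`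
realises `−T_i` as a `×∧` gate, which costs the extra level).

* `ASSS16.levelRecursion_faithful` — [ASSS16] §4's level recursion (Lemma 4.2 + Cor. 4.3 + Fact 1 /
  Thm. 2.1, assembled in `FSV18Thm48TopFanInHolds.lean` as `thm48_levelInvariant_step` over
  `ASSS16.baseLevel`) with the resources as PARAMETERS: any block sizes `r_ℓ` obeying `r_0 ≥ t` and
  the recursion inequality, any sparsity budget `B ≥ r_{D-3}!·s^{r_{D-3}}` of the bottom map `Φ`, the
  characteristic clause level by level; conclusion in Thm. 2.1 ("faithful") form for every family of
  `≤ t` occur-`k` size-`≤ s` sub-formulas of depth `≤ D-1`. (Same proof text as the keystone's Part C,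
  which fixed these parameters at the closed form.)
* `ASSS16.asssRec_double_le` & co. — the numerics: with `t = 2k`, `r_j ≤ (2k)^{2^{j+4}}`, hence the
  seed, sparsity and characteristic budgets of Cor. 49 dominate what the recursion consumes.
* `ASSS16.cor49_topFamilies_faithful` — the generator `Σ_ℓ Vdm_{r_ℓ} ⊕ G^{SV'}_{n,K-1}`
  (`K = asssK k D s`) is faithful to every family of `≤ 2k` occur-`k` size-`≤ s²` sub-formulas of
  depth `≤ D-1`, in characteristic `0` or `> s^R`.
* `ASSS16.cor49_addCase` — the `+`-gate case: "if `C` is non-constant … there is an `i` such that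
  `C̃ := C(…, x_i + 1, …) − C ≠ 0`" (`ASSS16.exists_shift_sub_ne_zero`), `C̃ = H(T(X+e_i), T)` for the
  faithful family above, so `Ψ_{K-1}(C̃) ≠ 0`, and the extra SV block supplies the shift
  (`isHittingSetGenerator_svGenCoeff_succ_of_shift`, FSV Fact 27): `Ψ_K(C) ≠ 0`.
* `ASSS16.cor49_pointwise` — every non-zero depth-`≤ D` occur-`k` size-`≤ s` formula is hit
  (leaves: FSV Cor. 34 `ForbesShpilkaVolk2018_svGeneratorHitsSparse_holds`; `×∧` gates: products of
  hit factors in a domain; `+` gates: the previous item), by induction on the depth.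
* `FSV2018_cor49_vdmLayout` — Cor. 49 in FSV Thm. 48's seed layout (Vandermonde blocks
  `X_i ↦ Σ_j y_{j,ℓ} t_ℓ^{ij}`), degenerate parameters (`k = 0`, `s ≤ 1`) included;
* `FSV2018_cor49_holds : FSV2018_cor49` — by "Proposition 17, possibly restricting excess `y_ℓ`
  variables to `0`" (the substitution of `FSV2018_cor49_of_thm48`, repeated here because that
  theorem consumes the whole of `FSV2018_thm48`).

Theorem-only: no definitions, no named facts; net debt `−1` (`FSV2018_cor49`). NOT touched:
`FSV2018_thm48` itself (abstract `Φ`: the shift `α + e_i` is not available for an arbitrary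
sparse-hitting block; its truth as typed stays open, caveat B21). Honest framing: literature
hygiene — a printed corollary of [FSV18]/[ASSS16] kernel-checked with its printed constants;
`VP ≠ VNP` is NOT proved and nothing here bears on it. bears_on: V4 (FSV2018-A residual facts).

## References
* [AgrawalEtAl2011] M. Agrawal, C. Saha, R. Saptharishi, N. Saxena, *Jacobian hits circuits:
  hitting-sets, lower bounds for depth-D occur-k formulas & depth-3 transcendence degree-k
  circuits*, STOC 2012 / SIAM J. Comput. 45(4) (2016), arXiv:1111.0582 — §4 (¶1: the shift
  reduction; Lemma 4.2, Cor. 4.3, Thm. dDkrPIT and its recursion `r_ℓ`, `c_ℓ`, "easy to bound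
  `r_{D-2}` by `R = (2k)^{2D·2^D}`", "char = 0 or > s^R"). Locators: paper:arxiv-1111.0582
  p0009:L3–L34, p0010:L1–L62.
* [ForbesShpilkaVolk2018] M. A. Forbes, A. Shpilka, B. L. Volk, *Succinct hitting sets and barriers to
  proving lower bounds for algebraic circuits*, Theory of Computing 14(18) (2018), arXiv:1701.05328 —
  Construction 46, Fact 47, Thm. 48, Cor. 49 (seq.; = ToC 5.22–5.25, pp. 29–30), Prop. 17, Fact 27,
  Cor. 34. Locators: paper:arxiv-1701.05328 p0021:L11–L50.
-/

noncomputable section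

namespace Literature.Computability.AlgebraicComplexity

open MvPolynomial Finset Literature.Barriers.ValiantsHypothesis
open Literature.RepresentationTheory.AlgebraicGroups (iterPderiv iterPderiv_zero)

namespace ASSS16

/-! ## Part 1. [ASSS16] §4's level recursion with the resources as parameters -/

section LevelRecursion

variable {F : Type*} [Field F] {n : ℕ}

/-- **[ASSS16] §4, the level recursion of Thm. dDkrPIT in Thm. 2.1 ("faithful") form, resources as
parameters.** Seed layout of FSV Thm. 48: `D - 2` Vandermonde block slots of `Rslot` seeds
(block `ℓ` = printed level `ℓ + 2`, using `r_ℓ ≤ Rslot` of them) on top of a map `Φ` in its own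
seeds. Hypotheses: `k ≥ 1`, `s ≥ 1`, `D ≥ 3`; block sizes with `r_0 ≥ t` ("`r_2 ≤ k`", here the
family size `t`) and `r_{ℓ+1} ≥ (ℓ+1)·2^{ℓ+1}·k·r_ℓ²` ("`r_{ℓ+1} := (c_ℓ + 1)·2^{c_ℓ+1}·k·r_ℓ²`,
`c_ℓ = ℓ - 2`, Lemma 4.2); `Φ` hits every polynomial with at most `B ≥ r_{D-3}!·s^{r_{D-3}}`
monomials (the sparse Jacobian minors of the leaf level, "using [KS01]"); characteristic `0` or
`> ((s+1)^{D-1-ℓ})^{r_ℓ}` at every level (Jacobian criterion, degree bound `(s+1)^{depth}` of FSV's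
size convention). Conclusion: `Ψ : x_m ↦ Σ_ℓ Vdm_{r_ℓ}(y_ℓ, t_ℓ)_m + Φ(w)_m` is faithful to every
family `G` of `≤ t` occur-`k` size-`≤ s` sub-formulas of depth `≤ D - 1` — `Q(G) ≠ 0 ↔ Q(Ψ ∘ G) ≠ 0`
for every polynomial `Q` ("`Ψ_2` is faithful to `T`", whence Thm. 2.1). Proof = the downward level
induction of `FSV2018_thm48_topFanIn_of_clause` (`FSV18Thm48TopFanInHolds.lean`, Part C) verbatim,
over `thm48_levelInvariant_step` (one level: Fact 1, Lemma 4.2 = `ASSS16.descentJacobian`,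
Cor. 4.3 = `ASSS16.descentFaithful`) and `ASSS16.baseLevel` (the level of the sparse polynomials).
[cite: AgrawalEtAl2011, §4 (Lemma 4.2, Cor. 4.3, Thm. dDkrPIT, proof)]
locator: paper:arxiv-1111.0582 p0009.txt:L24–L34, p0010.txt:L1–L62 -/
theorem levelRecursion_faithful {D k s t Rslot B : ℕ} {τ : Type*}
    (Φ : multilinearMonomials n → MvPolynomial τ F) (r : Fin (D - 2) → Fin (Rslot + 1))
    (hk : 1 ≤ k) (hs : 1 ≤ s) (hD : 3 ≤ D)
    (hr0 : ∀ ℓ : Fin (D - 2), (ℓ : ℕ) = 0 → t ≤ (r ℓ : ℕ))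
    (hstep : ∀ ℓ ℓ' : Fin (D - 2), (ℓ' : ℕ) = (ℓ : ℕ) + 1 →
      ((ℓ : ℕ) + 1) * 2 ^ ((ℓ : ℕ) + 1) * k * (r ℓ : ℕ) ^ 2 ≤ (r ℓ' : ℕ))
    (hB : ∀ ℓ : Fin (D - 2), (ℓ : ℕ) = D - 3 → (r ℓ : ℕ).factorial * s ^ (r ℓ : ℕ) ≤ B)
    (hclause : ringChar F = 0 ∨
      ∀ ℓ : Fin (D - 2), ((s + 1) ^ (D - 1 - (ℓ : ℕ))) ^ (r ℓ : ℕ) < ringChar F)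
    (hΦ : IsHittingSetGenerator
      {P : MvPolynomial (multilinearMonomials n) F | P.support.card ≤ B} Φ)
    (m : ℕ) (G : Fin m → OccurFormula F (multilinearMonomials n)) (hm : m ≤ t)
    (hocc : ∀ u i, (G u).occur i ≤ k) (hsize : ∀ u, (G u).size ≤ s)
    (hdepth : ∀ u, (G u).depth ≤ D - 1) (Q : MvPolynomial (Fin m) F) :
    aeval (fun u => (G u).eval) Q ≠ 0 ↔
      aeval (fun u => bind₁ (fun mm : multilinearMonomials n =>
          (∑ ℓ : Fin (D - 2),
            rename (fun v : Fin (r ℓ) ⊕ Unit =>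
                (Sum.inl (ℓ, Sum.map (Fin.castLE (Nat.lt_succ_iff.mp (r ℓ).isLt)) id v) :
                  (Fin (D - 2) × (Fin Rslot ⊕ Unit)) ⊕ τ))
              (vdmGenCoeff F n (r ℓ) (mm : Fin n →₀ ℕ))) +
            rename Sum.inr (Φ mm)) (G u).eval) Q ≠ 0 := by
  classical
  haveI : Fintype (multilinearMonomials n) := Fintype.ofEquiv (Fin (2 ^ n)) (binaryOrder n)
  -- the block sizes as a plain sequence
  obtain ⟨rN, hrN⟩ : ∃ rN : ℕ → ℕ, ∀ (j : ℕ) (hj : j < D - 2), rN j = (r ⟨j, hj⟩ : ℕ) :=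
    ⟨fun j => if hj : j < D - 2 then (r ⟨j, hj⟩ : ℕ) else 0, fun j hj => dif_pos hj⟩
  -- the seed slots of block `ℓ`, the blocks, the stage maps `Ψ_j` (blocks `≥ j` and `Φ`)
  set slot : (ℓ : Fin (D - 2)) → Fin (r ℓ) ⊕ Unit →
      (Fin (D - 2) × (Fin Rslot ⊕ Unit)) ⊕ τ :=
    fun ℓ v => Sum.inl (ℓ, Sum.map (Fin.castLE (Nat.lt_succ_iff.mp (r ℓ).isLt)) id v) with hslot
  set block : Fin (D - 2) → multilinearMonomials n →
      MvPolynomial ((Fin (D - 2) × (Fin Rslot ⊕ Unit)) ⊕ τ) F :=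
    fun ℓ mm => rename (slot ℓ) (vdmGenCoeff F n (r ℓ) (mm : Fin n →₀ ℕ)) with hblock
  set stageGen : ℕ → multilinearMonomials n →
      MvPolynomial ((Fin (D - 2) × (Fin Rslot ⊕ Unit)) ⊕ τ) F :=
    fun j mm => (∑ ℓ ∈ (Finset.univ : Finset (Fin (D - 2))).filter (fun ℓ : Fin (D - 2) => j ≤ ℓ.val),
      block ℓ mm) + rename Sum.inr (Φ mm) with hstageGen
  set Ψ : ℕ → (MvPolynomial (multilinearMonomials n) F →ₐ[F]
      MvPolynomial ((Fin (D - 2) × (Fin Rslot ⊕ Unit)) ⊕ τ) F) :=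
    fun j => aeval (stageGen j) with hΨ
  -- the slots are injective and pairwise apart; the stage maps split off one block at a time
  have hslotinj : ∀ ℓ, Function.Injective (slot ℓ) := by
    intro ℓ v w h
    rw [hslot] at h
    simp only [Sum.inl.injEq, Prod.mk.injEq, true_and] at h
    exact (Sum.map_injective.2 ⟨Fin.castLE_injective _, Function.injective_id⟩) h
  have hslotinr : ∀ ℓ v (w : τ), slot ℓ v ≠ Sum.inr w := by
    intro ℓ v w h
    rw [hslot] at h
    exact Sum.inl_ne_inr h
  have hsplit : ∀ (j : ℕ) (hj : j < D - 2) (mm : multilinearMonomials n),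
      stageGen j mm = block ⟨j, hj⟩ mm + stageGen (j + 1) mm := by
    intro j hj mm
    have hfilter : (Finset.univ.filter fun ℓ : Fin (D - 2) => j ≤ ℓ.val) =
        insert ⟨j, hj⟩ (Finset.univ.filter fun ℓ : Fin (D - 2) => j + 1 ≤ ℓ.val) := by
      ext ℓ
      simp only [Finset.mem_filter, Finset.mem_univ, true_and, Finset.mem_insert, Fin.ext_iff]
      omega
    have hnot : (⟨j, hj⟩ : Fin (D - 2)) ∉
        (Finset.univ.filter fun ℓ : Fin (D - 2) => j + 1 ≤ ℓ.val) := by simp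
    rw [hstageGen]
    simp only
    rw [hfilter, Finset.sum_insert hnot, add_assoc]
  have hΨsplit : ∀ (j : ℕ) (hj : j < D - 2), Ψ j = aeval (fun mm : multilinearMonomials n =>
      rename (slot ⟨j, hj⟩) (vdmGenCoeff F n (r ⟨j, hj⟩) (mm : Fin n →₀ ℕ)) + Ψ (j + 1) (X mm)) := by
    intro j hj
    refine MvPolynomial.algHom_ext fun mm => ?_
    rw [hΨ]
    simp only [aeval_X]
    rw [hsplit j hj mm, hblock]
  have hlast : ∀ mm : multilinearMonomials n, Ψ (D - 2) (X mm) = rename Sum.inr (Φ mm) := by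
    intro mm
    rw [hΨ]
    simp only [aeval_X]
    rw [hstageGen]
    simp only
    rw [Finset.filter_false_of_mem, Finset.sum_empty, zero_add]
    intro ℓ _
    exact not_le.2 ℓ.2
  -- block `j` is fresh for `Ψ_{j+1}`
  have hfresh : ∀ (j : ℕ) (hj : j < D - 2) (mm : multilinearMonomials n),
      ∀ v ∈ (Ψ (j + 1) (X mm)).vars, v ∉ Set.range (slot ⟨j, hj⟩) := by
    intro j hj mm v hv
    rintro ⟨w, rfl⟩
    rw [hΨ] at hv
    simp only [aeval_X] at hv
    rw [hstageGen] at hv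
    simp only at hv
    rcases Finset.mem_union.1 (vars_add_subset _ _ hv) with h | h
    · obtain ⟨ℓ, hℓ, hvℓ⟩ := Finset.mem_biUnion.1 (vars_sum_subset _ _ h)
      rw [hblock] at hvℓ
      obtain ⟨w', -, hw'⟩ := Finset.mem_image.1 (vars_rename _ _ hvℓ)
      have hjℓ : j + 1 ≤ (ℓ : ℕ) := (Finset.mem_filter.1 hℓ).2
      rw [hslot] at hw'
      simp only [Sum.inl.injEq, Prod.mk.injEq] at hw'
      have := congrArg Fin.val hw'.1
      simp only at this
      omega
    · obtain ⟨w', -, hw'⟩ := Finset.mem_image.1 (vars_rename _ _ h)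
      exact hslotinr _ _ _ hw'.symm
  -- the level-wise characteristic clause
  have hclause' : ∀ (j : ℕ) (hj : j < D - 2),
      (ringChar F = 0 ∨ ((s + 1) ^ (D - 1 - j)) ^ (r ⟨j, hj⟩ : ℕ) < ringChar F) :=
    fun j hj => hclause.imp id fun h => h ⟨j, hj⟩
  -- THE LEVEL INDUCTION: `key i j _` = INV(j) for `i + j + 3 = D`
  have key : ∀ i j : ℕ, i + j + 3 = D →
      ∀ (m : ℕ) (G : Fin m → OccurFormula F (multilinearMonomials n))
        (T : Fin m → multilinearMonomials n →₀ ℕ),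
        m ≤ rN j → (∀ u i', (G u).occur i' ≤ k) → (∀ u, (G u).size ≤ s) →
        (∀ u, (G u).depth ≤ D - 1 - j) → (∀ u, (T u).degree ≤ j) →
        ∀ C : MvPolynomial (Fin m) F,
          aeval (fun u => iterPderiv (A := F) (T u) (G u).eval) C ≠ 0 ↔
            aeval (fun u => Ψ j (iterPderiv (A := F) (T u) (G u).eval)) C ≠ 0 := by
    intro i
    induction i with
    | zero =>
      intro j hj m G T hm hocc hsize hdepth hT C
      have hj' : j < D - 2 := by omega
      have hj1 : j + 1 = D - 2 := by omega
      have h2 : D - 1 - j = 2 := by omega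
      rw [hrN j hj'] at hm
      rw [hΨsplit j hj']
      have hmap : (fun mm : multilinearMonomials n =>
          rename (slot ⟨j, hj'⟩) (vdmGenCoeff F n (r ⟨j, hj'⟩) (mm : Fin n →₀ ℕ)) +
            Ψ (j + 1) (X mm)) =
          fun mm : multilinearMonomials n =>
            rename (slot ⟨j, hj'⟩) (vdmGenCoeff F n (r ⟨j, hj'⟩) (mm : Fin n →₀ ℕ)) +
              rename Sum.inr (Φ mm) := by
        funext mm
        rw [hj1, hlast]
      rw [hmap]
      have hchar := hclause' j hj'
      rw [h2] at hchar
      exact ASSS16.baseLevel (fun u => (G u).eval) T hs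
        (fun u => OccurFormula.card_support_eval_le_of_depth_le_two hs (G u)
          (by rw [← h2]; exact hdepth u) (hsize u))
        (fun u => OccurFormula.totalDegree_iterPderiv_eval_le (G u) (hsize u)
          (by rw [← h2]; exact hdepth u) (T u))
        hm hchar (hB ⟨j, hj'⟩ (by simp only; omega)) Φ hΦ
        Sum.inr Sum.inr_injective (slot ⟨j, hj'⟩) (hslotinj ⟨j, hj'⟩) (hslotinr ⟨j, hj'⟩) C
    | succ i ih =>
      intro j hj m G T hm hocc hsize hdepth hT C
      have hj' : j < D - 2 := by omega
      have hj1 : j + 1 < D - 2 := by omega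
      rw [hrN j hj'] at hm
      rw [hΨsplit j hj']
      refine thm48_levelInvariant_step k s (D - 1 - j) j (r ⟨j, hj'⟩) (r ⟨j + 1, hj1⟩)
        (by omega) hk (hstep ⟨j, hj'⟩ ⟨j + 1, hj1⟩ rfl) (Ψ (j + 1)) (slot ⟨j, hj'⟩) (hslotinj _)
        (hfresh j hj') (hclause' j hj') ?_ m G T hm hocc hsize hdepth hT C
      intro m' H T' hm' hoccH hsizeH hdepthH hT' Q'
      exact ih (j + 1) (by omega) m' H T' (by rw [hrN (j + 1) hj1]; exact hm') hoccH hsizeH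
        (fun u => by have := hdepthH u; omega) hT' Q'
  -- THE TOP LEVEL
  have hm0 : m ≤ rN 0 := by
    rw [hrN 0 (by omega)]
    exact hm.trans (hr0 ⟨0, by omega⟩ rfl)
  have hdepth0 : ∀ u, (G u).depth ≤ D - 1 - 0 := fun u => by have := hdepth u; omega
  have hfaith := key (D - 3) 0 (by omega) m G (fun _ => 0) hm0 hocc hsize hdepth0
    (fun _ => by simp) Q
  have e0 : ∀ u, iterPderiv (A := F) (0 : multilinearMonomials n →₀ ℕ) (G u).eval = (G u).eval :=
    fun u => by rw [iterPderiv_zero]; rfl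
  simp only [e0] at hfaith
  have h0 : (Finset.univ.filter fun ℓ : Fin (D - 2) => 0 ≤ ℓ.val) = Finset.univ :=
    Finset.filter_true_of_mem fun _ _ => Nat.zero_le _
  have hgen : (fun mm : multilinearMonomials n =>
      (∑ ℓ : Fin (D - 2), rename (fun v : Fin (r ℓ) ⊕ Unit =>
          (Sum.inl (ℓ, Sum.map (Fin.castLE (Nat.lt_succ_iff.mp (r ℓ).isLt)) id v) :
            (Fin (D - 2) × (Fin Rslot ⊕ Unit)) ⊕ τ))
        (vdmGenCoeff F n (r ℓ) (mm : Fin n →₀ ℕ))) + rename Sum.inr (Φ mm)) = stageGen 0 := by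
    funext mm
    simp only [hstageGen, hblock, hslot, h0]
  rw [hgen]
  exact hfaith

end LevelRecursion

/-! ## Part 2. The numerics of Cor. 49: the recursion started at `t = 2k` against the closed form
`R = (2k)^{2D·2^D}`, the SV seed budget `R⌈log s⌉ + R⌈log R⌉ - 1` and the threshold `s^R` -/

section Numerics

/-- `r_{2+j} ≤ (2k)^{2^{j+4}}` for the recursion started at `t = 2k` ("it is easy to bound `r_{D-2}`";
from `asssRec_fst_le_pow_max`: `r_{2+j} ≤ (4k)^{2^{j+3} - 2j - 4}` and `4k ≤ (2k)²`).
[cite: AgrawalEtAl2011, §4 (Thm. dDkrPIT, proof)] locator: paper:arxiv-1111.0582 p0010.txt:L40–L43 -/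
theorem asssRec_double_le {k : ℕ} (hk : 1 ≤ k) (j : ℕ) :
    (asssRec k (2 * k) j).1 ≤ (2 * k) ^ 2 ^ (j + 4) := by
  have hK : max k (2 * k) = 2 * k := max_eq_right (by omega)
  have h1 := asssRec_fst_le_pow_max (k := k) (t := 2 * k) (by rw [hK]; omega) j
  rw [hK] at h1
  have h4 : 2 * (2 * k) ≤ (2 * k) ^ 2 := by
    rw [sq]
    exact Nat.mul_le_mul_right (2 * k) (by omega)
  have hexp : 2 * (2 ^ (j + 3) - 2 * j - 4) ≤ 2 ^ (j + 4) := by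
    have : 2 ^ (j + 4) = 2 * 2 ^ (j + 3) := by rw [pow_succ, mul_comm]
    omega
  calc (asssRec k (2 * k) j).1 ≤ (2 * (2 * k)) ^ (2 ^ (j + 3) - 2 * j - 4) := h1
    _ ≤ ((2 * k) ^ 2) ^ (2 ^ (j + 3) - 2 * j - 4) := Nat.pow_le_pow_left h4 _
    _ = (2 * k) ^ (2 * (2 ^ (j + 3) - 2 * j - 4)) := by rw [← pow_mul]
    _ ≤ (2 * k) ^ 2 ^ (j + 4) := Nat.pow_le_pow_right (by omega) hexp

/-- … hence `r_{2+j} ≤ (2k)^{2^{D+1}}` at every level index `j ≤ D - 3` of the FSV model.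
[cite: AgrawalEtAl2011, §4 (Thm. dDkrPIT, proof)] locator: paper:arxiv-1111.0582 p0010.txt:L40–L43 -/
theorem asssRec_double_le_of_le_sub_three {k D j : ℕ} (hk : 1 ≤ k) (hj : j + 3 ≤ D) :
    (asssRec k (2 * k) j).1 ≤ (2 * k) ^ 2 ^ (D + 1) :=
  (asssRec_double_le hk j).trans
    (Nat.pow_le_pow_right (by omega) (Nat.pow_le_pow_right (by norm_num) (by omega)))

/-- The exponent bookkeeping: `2^{D+1} + 2 ≤ 2D·2^D` and `2D + 2^{D+1} ≤ 2D·2^D` for `D ≥ 2`.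
[folklore] -/
private theorem two_pow_succ_budget {D : ℕ} (hD : 2 ≤ D) :
    2 ^ (D + 1) + 2 ≤ 2 * D * 2 ^ D ∧ 2 * D + 2 ^ (D + 1) ≤ 2 * D * 2 ^ D := by
  have hP : 4 ≤ 2 ^ D := by
    calc (4 : ℕ) = 2 ^ 2 := by norm_num
      _ ≤ 2 ^ D := Nat.pow_le_pow_right (by norm_num) hD
  have hPD : D < 2 ^ D := Nat.lt_two_pow_self
  have h2 : 2 ^ (D + 1) = 2 * 2 ^ D := by rw [pow_succ, mul_comm]
  rw [h2]
  constructor <;> nlinarith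

/-- **The block sizes fit Cor. 49's `R = (2k)^{2D·2^D}` seeds:** `r_{2+j} ≤ asssR k D` (`j ≤ D - 3`).
[cite: AgrawalEtAl2011, §4 (Thm. dDkrPIT, proof); ForbesShpilkaVolk2018, Construction 46 (seq.) = ToC Construction 5.22]
locator: paper:arxiv-1111.0582 p0010.txt:L40–L43; paper:arxiv-1701.05328 p0021.txt:L11 -/
theorem asssRec_double_le_asssR {k D j : ℕ} (hk : 1 ≤ k) (hj : j + 3 ≤ D) :
    (asssRec k (2 * k) j).1 ≤ asssR k D := by
  unfold asssR
  refine (asssRec_double_le_of_le_sub_three hk hj).trans (Nat.pow_le_pow_right (by omega) ?_)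
  have := (two_pow_succ_budget (D := D) (by omega)).1
  omega

/-- `2·r_{2+j} + 1 ≤ R` (`j ≤ D - 3`): the SV-budget bookkeeping `2r ≤ R`, `r + 1 ≤ R`.
[cite: AgrawalEtAl2011, §4 (Thm. dDkrPIT, proof)] locator: paper:arxiv-1111.0582 p0010.txt:L40–L43 -/
theorem two_mul_asssRec_double_succ_le_asssR {k D j : ℕ} (hk : 1 ≤ k) (hj : j + 3 ≤ D) :
    2 * (asssRec k (2 * k) j).1 + 1 ≤ asssR k D := by
  unfold asssR
  have h2k : 2 ≤ 2 * k := by omega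
  have hM := asssRec_double_le_of_le_sub_three hk hj
  have hpos : 1 ≤ (2 * k) ^ (2 ^ (D + 1) + 1) := Nat.one_le_pow _ _ (by omega)
  have hE := (two_pow_succ_budget (D := D) (by omega)).1
  calc 2 * (asssRec k (2 * k) j).1 + 1
      ≤ 2 * k * (2 * k) ^ 2 ^ (D + 1) + (2 * k) ^ (2 ^ (D + 1) + 1) := by
        have : 2 * (asssRec k (2 * k) j).1 ≤ 2 * k * (2 * k) ^ 2 ^ (D + 1) :=
          (Nat.mul_le_mul_left 2 hM).trans (Nat.mul_le_mul_right _ h2k)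
        omega
    _ = 2 * (2 * k) ^ (2 ^ (D + 1) + 1) := by ring
    _ ≤ 2 * k * (2 * k) ^ (2 ^ (D + 1) + 1) := Nat.mul_le_mul_right _ h2k
    _ = (2 * k) ^ (2 ^ (D + 1) + 2) := by ring
    _ ≤ (2 * k) ^ (2 * D * 2 ^ D) := Nat.pow_le_pow_right (by omega) hE

/-- `3D ≤ 4^D`. [folklore] -/
private theorem three_mul_le_four_pow (D : ℕ) : 3 * D ≤ 4 ^ D := by
  induction D with
  | zero => simp
  | succ D ih =>
    have h1 : 1 ≤ 4 ^ D := Nat.one_le_pow _ _ (by norm_num)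
    rw [pow_succ]
    omega

/-- **The characteristic bookkeeping:** `3D · r_{2+j} ≤ R = asssR k D` (`j ≤ D - 3`), so that the
level-wise Jacobian thresholds `((s²+1)^{D-1-j})^{r_{2+j}} ≤ s^{3D·r_{2+j}}` stay below `s^R`.
[cite: AgrawalEtAl2011, §4 (Thm. dDkrPIT: "we need char(𝔽) = 0 or > s^R")] locator: paper:arxiv-1111.0582 p0010.txt:L60–L62 -/
theorem three_mul_mul_asssRec_double_le_asssR {k D j : ℕ} (hk : 1 ≤ k) (hj : j + 3 ≤ D) :
    3 * D * (asssRec k (2 * k) j).1 ≤ asssR k D := by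
  unfold asssR
  have hM := asssRec_double_le_of_le_sub_three hk hj
  have hE := (two_pow_succ_budget (D := D) (by omega)).2
  have h3 : 3 * D ≤ (2 * k) ^ (2 * D) :=
    calc 3 * D ≤ 4 ^ D := three_mul_le_four_pow D
      _ = 2 ^ (2 * D) := by rw [pow_mul]; norm_num
      _ ≤ (2 * k) ^ (2 * D) := Nat.pow_le_pow_left (by omega) _
  calc 3 * D * (asssRec k (2 * k) j).1 ≤ (2 * k) ^ (2 * D) * (2 * k) ^ 2 ^ (D + 1) :=
        Nat.mul_le_mul h3 hM
    _ = (2 * k) ^ (2 * D + 2 ^ (D + 1)) := (pow_add _ _ _).symm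
    _ ≤ (2 * k) ^ (2 * D * 2 ^ D) := Nat.pow_le_pow_right (by omega) hE

/-- **Cor. 49's inherited clause dominates the level-wise clause of the recursion at `t = 2k`,
size `s²`:** `((s²+1)^{D-1-j})^{r_{2+j}} ≤ s^{asssR k D}` for `s ≥ 2`, `k ≥ 1`, `j ≤ D - 3`.
[cite: AgrawalEtAl2011, §4 (Thm. dDkrPIT: "char(𝔽) = 0 or > s^R"); ForbesShpilkaVolk2018, Thm. 48 and Cor. 49 (seq.) = ToC Thm. 5.24, Cor. 5.25]
locator: paper:arxiv-1111.0582 p0010.txt:L60–L62; paper:arxiv-1701.05328 p0021.txt:L31–L45 -/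
theorem cor49_level_clause_le {s k D j : ℕ} (hs : 2 ≤ s) (hk : 1 ≤ k) (hj : j + 3 ≤ D) :
    ((s ^ 2 + 1) ^ (D - 1 - j)) ^ (asssRec k (2 * k) j).1 ≤ s ^ asssR k D := by
  have hs1 : 1 ≤ s := by omega
  have hs3 : s ^ 2 + 1 ≤ s ^ 3 := by nlinarith
  calc ((s ^ 2 + 1) ^ (D - 1 - j)) ^ (asssRec k (2 * k) j).1
      ≤ ((s ^ 3) ^ D) ^ (asssRec k (2 * k) j).1 := by
        refine Nat.pow_le_pow_left ((Nat.pow_le_pow_left hs3 _).trans ?_) _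
        exact Nat.pow_le_pow_right (by positivity) (by omega)
    _ = s ^ (3 * D * (asssRec k (2 * k) j).1) := by rw [← pow_mul, ← pow_mul, mul_assoc]
    _ ≤ s ^ asssR k D := Nat.pow_le_pow_right hs1 (three_mul_mul_asssRec_double_le_asssR hk hj)

/-- `2 ≤ R = asssR k D` for `k ≥ 1`, `D ≥ 1`. [cite: ForbesShpilkaVolk2018, Construction 46 (seq.) = ToC Construction 5.22] -/
theorem two_le_asssR {k D : ℕ} (hk : 1 ≤ k) (hD : 1 ≤ D) : 2 ≤ asssR k D := by
  unfold asssR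
  calc 2 ≤ 2 * k := by omega
    _ = (2 * k) ^ 1 := (pow_one _).symm
    _ ≤ (2 * k) ^ (2 * D * 2 ^ D) :=
        Nat.pow_le_pow_right (by omega) (Nat.one_le_iff_ne_zero.2 (by positivity))

/-- `(s+1)^D ≤ s^R` (`s ≥ 2`): the degree bound of a depth-`D` size-`s` formula
(`totalDegree_le_of_mem_occurClass`) is below Cor. 49's characteristic threshold, as the shift lemma
("assuming char exceeds the degree of `C`") needs. [cite: AgrawalEtAl2011, §4 (¶1)]
locator: paper:arxiv-1111.0582 p0009.txt:L3–L8 -/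
theorem succ_pow_le_pow_asssR {s k D : ℕ} (hs : 2 ≤ s) (hk : 1 ≤ k) :
    (s + 1) ^ D ≤ s ^ asssR k D := by
  have hs2 : s + 1 ≤ s ^ 2 := by nlinarith
  have h2D : 2 * D ≤ asssR k D := by
    unfold asssR
    calc 2 * D ≤ 2 * D * 2 ^ D := Nat.le_mul_of_pos_right _ (by positivity)
      _ ≤ 2 ^ (2 * D * 2 ^ D) := Nat.lt_two_pow_self.le
      _ ≤ (2 * k) ^ (2 * D * 2 ^ D) := Nat.pow_le_pow_left (by omega) _
  calc (s + 1) ^ D ≤ (s ^ 2) ^ D := Nat.pow_le_pow_left hs2 _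
    _ = s ^ (2 * D) := by rw [← pow_mul]
    _ ≤ s ^ asssR k D := Nat.pow_le_pow_right (by omega) h2D

/-- **The SV seed budget:** all but one of the `R⌈log₂ s⌉ + R⌈log₂ R⌉` SV blocks of Construction 46
hit the sparse Jacobian minors of the leaf-derivative families of size `s²`:
`2 · (r_{D-1}! · (s²)^{r_{D-1}}) ≤ 2^{asssK k D s}` (`r_{D-1} = r_{2+(D-3)} ≤ (2k)^{2^{D+1}}`,
`2r + 1 ≤ R`, `r! ≤ R^r`, `R^R s^R ≤ 2^{R⌈log R⌉ + R⌈log s⌉}`).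
[cite: ForbesShpilkaVolk2018, Construction 46 and Cor. 49 (seq.) = ToC 5.22 / 5.25; AgrawalEtAl2011, §4 (Thm. dDkrPIT, proof: "sparsity … `s^R`")]
locator: paper:arxiv-1701.05328 p0021.txt:L11–L50; paper:arxiv-1111.0582 p0010.txt:L49–L55 -/
theorem cor49_sv_budget {s k D : ℕ} (hs : 1 ≤ s) (hk : 1 ≤ k) (hD : 3 ≤ D) :
    2 * (((asssRec k (2 * k) (D - 3)).1).factorial * (s ^ 2) ^ (asssRec k (2 * k) (D - 3)).1) ≤
      2 ^ asssK k D s := by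
  set rb := (asssRec k (2 * k) (D - 3)).1 with hrb
  set R := asssR k D with hR
  have h21 : 2 * rb + 1 ≤ R := two_mul_asssRec_double_succ_le_asssR hk (by omega)
  have hR2 : 2 ≤ R := two_le_asssR hk (by omega)
  have hR1 : 1 ≤ R := by omega
  have hfact : rb.factorial ≤ R ^ rb :=
    (Nat.factorial_le_pow rb).trans (Nat.pow_le_pow_left (by omega) rb)
  have hsq : (s ^ 2) ^ rb ≤ s ^ R := by
    rw [← pow_mul]
    exact Nat.pow_le_pow_right hs (by omega)
  have hRR : 2 * R ^ rb ≤ R ^ R :=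
    calc 2 * R ^ rb ≤ R * R ^ rb := Nat.mul_le_mul_right _ hR2
      _ = R ^ (rb + 1) := (pow_succ' _ _).symm
      _ ≤ R ^ R := Nat.pow_le_pow_right hR1 (by omega)
  calc 2 * (rb.factorial * (s ^ 2) ^ rb) = (2 * rb.factorial) * (s ^ 2) ^ rb := by ring
    _ ≤ (2 * R ^ rb) * s ^ R := Nat.mul_le_mul (Nat.mul_le_mul_left 2 hfact) hsq
    _ ≤ R ^ R * s ^ R := Nat.mul_le_mul_right _ hRR
    _ ≤ (2 ^ Nat.clog 2 R) ^ R * (2 ^ Nat.clog 2 s) ^ R :=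
        Nat.mul_le_mul (Nat.pow_le_pow_left (Nat.le_pow_clog one_lt_two R) R)
          (Nat.pow_le_pow_left (Nat.le_pow_clog one_lt_two s) R)
    _ = 2 ^ asssK k D s := by
        rw [asssK, ← hR, ← pow_mul, ← pow_mul, ← pow_add]
        congr 1
        ring

/-- `1 ≤ asssK k D s` and `s ≤ 2^{asssK k D s}` for `k ≥ 1`, `D ≥ 1` (the SV block alone hits the
size-`≤ s` leaves, FSV Cor. 34). [cite: ForbesShpilkaVolk2018, Construction 46 and Cor. 34 (seq.) = ToC 5.22, 5.10] -/
theorem one_le_asssK_and_le_two_pow {s k D : ℕ} (hk : 1 ≤ k) (hD : 1 ≤ D) :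
    1 ≤ asssK k D s ∧ s ≤ 2 ^ asssK k D s := by
  have hR2 : 2 ≤ asssR k D := two_le_asssR hk hD
  have hclog : 1 ≤ Nat.clog 2 (asssR k D) := Nat.clog_pos one_lt_two hR2
  constructor
  · unfold asssK
    nlinarith
  · calc s ≤ 2 ^ Nat.clog 2 s := Nat.le_pow_clog one_lt_two s
      _ ≤ 2 ^ asssK k D s := by
          refine Nat.pow_le_pow_right (by norm_num) ?_
          unfold asssK
          nlinarith

end Numerics

/-! ## Part 3. Cor. 49 pointwise: the `+` gate by the shift `α + e_{m₀}` (faithfulness to the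
shifted and unshifted children), `×∧` gates factor by factor, leaves by FSV Cor. 34 -/

section Assembly

variable {F : Type*} [Field F] {n : ℕ}

/-- **The Vandermonde blocks of Cor. 49 on top of all but one SV block are faithful to every
family of `≤ 2k` occur-`k` size-`≤ s²` sub-formulas of depth `≤ D - 1`** (characteristic `0` or
`> s^R`, `R = asssR k D`, `K₀ + 1 = asssK k D s` SV blocks in all): `levelRecursion_faithful` at
`t = 2k`, size `s²`, `Φ :=` the shifted SV generator `G^{SV'}_{n,K₀}` — a hitting-set generator for
the polynomials with `≤ 2^{K₀}` monomials (FSV Cor. 34, `ForbesShpilkaVolk2018_svGeneratorHitsSparse_holds`)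
— with the budgets of Part 2. [cite: AgrawalEtAl2011, §4 (Thm. dDkrPIT, proof); ForbesShpilkaVolk2018, Cor. 34 and Cor. 49 (seq.) = ToC Cor. 5.10, Cor. 5.25]
locator: paper:arxiv-1111.0582 p0009.txt:L24–L34, p0010.txt:L40–L62; paper:arxiv-1701.05328 p0021.txt:L41–L50 -/
theorem cor49_topFamilies_faithful {D k s Rslot K₀ : ℕ} (hk : 1 ≤ k) (hs : 2 ≤ s) (hD : 3 ≤ D)
    (hchar : ringChar F = 0 ∨ s ^ asssR k D < ringChar F) (hK : K₀ + 1 = asssK k D s)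
    (r : Fin (D - 2) → Fin (Rslot + 1)) (hr : ∀ ℓ, (r ℓ : ℕ) = (asssRec k (2 * k) ℓ).1)
    (m : ℕ) (G : Fin m → OccurFormula F (multilinearMonomials n)) (hm : m ≤ 2 * k)
    (hocc : ∀ u i, (G u).occur i ≤ k) (hsize : ∀ u, (G u).size ≤ s ^ 2)
    (hdepth : ∀ u, (G u).depth ≤ D - 1) (Q : MvPolynomial (Fin m) F) :
    aeval (fun u => (G u).eval) Q ≠ 0 ↔
      aeval (fun u => bind₁ (fun mm : multilinearMonomials n =>
          (∑ ℓ : Fin (D - 2),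
            rename (fun v : Fin (r ℓ) ⊕ Unit =>
                (Sum.inl (ℓ, Sum.map (Fin.castLE (Nat.lt_succ_iff.mp (r ℓ).isLt)) id v) :
                  (Fin (D - 2) × (Fin Rslot ⊕ Unit)) ⊕ (Fin K₀ ⊕ (Fin K₀ × Fin n))))
              (vdmGenCoeff F n (r ℓ) (mm : Fin n →₀ ℕ))) +
            rename Sum.inr (svGenCoeff F n K₀ (mm : Fin n →₀ ℕ))) (G u).eval) Q ≠ 0 := by
  have hs1 : 1 ≤ s := by omega
  refine levelRecursion_faithful (s := s ^ 2) (t := 2 * k) (B := 2 ^ K₀)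
    (fun mm : multilinearMonomials n => svGenCoeff F n K₀ (mm : Fin n →₀ ℕ)) r hk
    (Nat.one_le_pow _ _ hs1) hD ?_ ?_ ?_ ?_ ?_ m G hm hocc hsize hdepth Q
  · -- `r_2 = t`
    intro ℓ hℓ
    rw [hr ℓ, hℓ]
    exact le_rfl
  · -- the recursion `r_{ℓ+1} = (c_ℓ+1)·2^{c_ℓ+1}·k·r_ℓ²`
    intro ℓ ℓ' hℓ'
    rw [hr ℓ, hr ℓ', hℓ', asssRec_fst_succ]
  · -- the SV budget of the bottom level
    intro ℓ hℓ
    rw [hr ℓ, hℓ]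
    have h := cor49_sv_budget (s := s) hs1 hk hD
    rw [← hK, pow_succ' 2 K₀] at h
    exact Nat.le_of_mul_le_mul_left h (by norm_num)
  · -- the characteristic clause, level by level
    refine hchar.imp id fun h ℓ => lt_of_le_of_lt ?_ h
    rw [hr ℓ]
    exact cor49_level_clause_le hs hk (by have := ℓ.2; omega)
  · -- FSV Cor. 34: `G^{SV'}_{n,K₀}` hits the polynomials with `≤ 2^{K₀}` monomials
    intro P hP hP0
    exact ForbesShpilkaVolk2018_svGeneratorHitsSparse_holds F n K₀ P hP0 hP

/-- **[ASSS16] §4 ¶1 + Thm. dDkrPIT for a `+` gate of arbitrary fan-in, generator form (the heart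
of Cor. 49 as typed).** For `C = Σ_i T_i ≠ 0` computed by a `+`-rooted depth-`≤ D` occur-`k`
size-`≤ s` formula: if `C` is constant it is untouched; otherwise "there is an `i` such that
`C̃ := C(…, x_i + 1, …) − C ≠ 0`" (`exists_shift_sub_ne_zero`, `char > (s+1)^D ≥ deg C`), and
`C̃ = Σ_{T ∋ x_i} (T(X + e_i) − T)` — "since `x_i` occurs in at most `k` of the `T_i`'s, `C̃` has top fanin
at most `2k`" — is `H(T'_1, …, T'_c, T_1, …, T_c)` with `H = Σ X_j − Σ X'_j` for the family of the
`c ≤ k` touched children and their shifted copies (`OccurFormula.exists_unitShift`: depth kept, size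
`≤ s²`), to which `Σ_ℓ Vdm_{r_ℓ} ⊕ G^{SV'}_{n,K₀}` is faithful (`cor49_topFamilies_faithful`); so that
map does not kill `C̃`, and the extra SV block realises the shift: `Σ_ℓ Vdm_{r_ℓ} ⊕ G^{SV'}_{n,K₀+1}`
does not kill `C` (`isHittingSetGenerator_svGenCoeff_succ_of_shift`, FSV Fact 27).
[cite: AgrawalEtAl2011, §4 (¶1 and Thm. dDkrPIT); ForbesShpilkaVolk2018, Fact 27 and Cor. 49 (seq.) = ToC Fact 5.3, Cor. 5.25]
locator: paper:arxiv-1111.0582 p0009.txt:L3–L34; paper:arxiv-1701.05328 p0021.txt:L41–L50 -/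
theorem cor49_addCase {D k s Rslot K₀ : ℕ} (hk : 1 ≤ k) (hs : 2 ≤ s)
    (hchar : ringChar F = 0 ∨ s ^ asssR k D < ringChar F) (hK : K₀ + 1 = asssK k D s)
    (r : Fin (D - 2) → Fin (Rslot + 1)) (hr : ∀ ℓ, (r ℓ : ℕ) = (asssRec k (2 * k) ℓ).1)
    (as : OccurArgs F (multilinearMonomials n)) (hdepth : (OccurFormula.add as).depth ≤ D)
    (hocc : ∀ i, (OccurFormula.add as).occur i ≤ k) (hsize : (OccurFormula.add as).size ≤ s)
    (h0 : as.evalSum ≠ 0) :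
    bind₁ (fun mm : multilinearMonomials n =>
        (∑ ℓ : Fin (D - 2),
          rename (fun v : Fin (r ℓ) ⊕ Unit =>
              (Sum.inl (ℓ, Sum.map (Fin.castLE (Nat.lt_succ_iff.mp (r ℓ).isLt)) id v) :
                (Fin (D - 2) × (Fin Rslot ⊕ Unit)) ⊕ (Fin (K₀ + 1) ⊕ (Fin (K₀ + 1) × Fin n))))
            (vdmGenCoeff F n (r ℓ) (mm : Fin n →₀ ℕ))) +
          rename Sum.inr (svGenCoeff F n (K₀ + 1) (mm : Fin n →₀ ℕ))) as.evalSum ≠ 0 := by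
  classical
  haveI : Fintype (multilinearMonomials n) := Fintype.ofEquiv (Fin (2 ^ n)) (binaryOrder n)
  -- the Vandermonde part and the two spellings of the seed layout
  set Gv : multilinearMonomials n → MvPolynomial (Fin (D - 2) × (Fin Rslot ⊕ Unit)) F :=
    fun mm => ∑ ℓ : Fin (D - 2), rename (fun v : Fin (r ℓ) ⊕ Unit =>
      ((ℓ, Sum.map (Fin.castLE (Nat.lt_succ_iff.mp (r ℓ).isLt)) id v) :
        Fin (D - 2) × (Fin Rslot ⊕ Unit)))
      (vdmGenCoeff F n (r ℓ) (mm : Fin n →₀ ℕ)) with hGv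
  have hlayout : ∀ (K : ℕ), (fun mm : multilinearMonomials n =>
      (∑ ℓ : Fin (D - 2), rename (fun v : Fin (r ℓ) ⊕ Unit =>
          (Sum.inl (ℓ, Sum.map (Fin.castLE (Nat.lt_succ_iff.mp (r ℓ).isLt)) id v) :
            (Fin (D - 2) × (Fin Rslot ⊕ Unit)) ⊕ (Fin K ⊕ (Fin K × Fin n))))
        (vdmGenCoeff F n (r ℓ) (mm : Fin n →₀ ℕ))) +
        rename Sum.inr (svGenCoeff F n K (mm : Fin n →₀ ℕ))) =
      fun mm => rename Sum.inl (Gv mm) + rename Sum.inr (svGenCoeff F n K (mm : Fin n →₀ ℕ)) := by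
    intro K
    funext mm
    rw [hGv]
    simp only [map_sum, rename_rename]
    rfl
  rw [hlayout (K₀ + 1)]
  set C₀ : MvPolynomial (multilinearMonomials n) F := as.evalSum with hC₀
  -- a constant `C` is untouched
  by_cases hdeg : C₀.totalDegree = 0
  · have hc : C₀ = C (coeff 0 C₀) := (totalDegree_eq_zero_iff_eq_C).1 hdeg
    rw [hc, bind₁_C_right, Ne, C_eq_zero]
    intro h
    exact h0 (by rw [hc, h, C_0])
  -- otherwise `D ≥ 3` (children of depth `≤ 1` compute constants)
  have hD : 3 ≤ D := by
    by_contra hD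
    have h1 : as.depth ≤ 1 := by rw [OccurFormula.depth] at hdepth; omega
    obtain ⟨c, hc⟩ := OccurArgs.exists_evalSum_eq_C_of_depth_le_one as h1
    exact hdeg (by rw [hC₀, hc, totalDegree_C])
  -- "there is an `i` such that `C̃ := C(…, x_i + 1, …) − C ≠ 0`"
  have hmem : C₀ ∈ occurClass F (multilinearMonomials n) D k s :=
    ⟨OccurFormula.add as, by rw [hC₀, OccurFormula.eval], hdepth, hocc, hsize⟩
  have hcharC : ringChar F = 0 ∨ C₀.totalDegree < ringChar F :=
    hchar.imp id fun h => lt_of_le_of_lt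
      ((totalDegree_le_of_mem_occurClass hmem).trans (succ_pow_le_pow_asssR hs hk)) h
  obtain ⟨m₀, hm₀⟩ := exists_shift_sub_ne_zero C₀ hdeg hcharC
  set Δ : MvPolynomial (multilinearMonomials n) F :=
    aeval (fun m : multilinearMonomials n =>
      if m = m₀ then X m + C 1 else (X m : MvPolynomial (multilinearMonomials n) F)) C₀ - C₀ with hΔ
  -- `Σ_ℓ Vdm_{r_ℓ} ⊕ G^{SV'}_{n,K₀}` does not kill `C̃`: faithfulness to the touched children
  have hgen : IsHittingSetGenerator ({Δ} : Set (MvPolynomial (multilinearMonomials n) F))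
      (fun mm : multilinearMonomials n =>
        rename Sum.inl (Gv mm) + rename Sum.inr (svGenCoeff F n K₀ (mm : Fin n →₀ ℕ))) := by
    intro P hP _
    rw [Set.mem_singleton_iff] at hP
    rw [hP]
    -- the children `T_u` of the root, their bounds, their shifted copies `T'_u`
    obtain ⟨m, G, hev, hoccsum, hsz, hdp⟩ := OccurArgs.exists_fin_view as
    have hoccG : ∀ u i, (G u).occur i ≤ k := fun u i => by
      have h1 := hocc i
      rw [OccurFormula.occur, hoccsum] at h1
      exact (Finset.single_le_sum (f := fun v => (G v).occur i) (fun _ _ => Nat.zero_le _)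
        (Finset.mem_univ u)).trans h1
    have hsizeG : ∀ u, (G u).size ≤ s := fun u => by
      have h1 := hsize
      rw [OccurFormula.size, hsz] at h1
      exact (Finset.single_le_sum (f := fun v => (G v).size) (fun _ _ => Nat.zero_le _)
        (Finset.mem_univ u)).trans (by omega)
    have hdepthG : ∀ u, (G u).depth ≤ D - 1 := fun u => by
      have h1 := hdepth
      rw [OccurFormula.depth] at h1
      have := hdp u
      omega
    choose T' hT'ev hT'dep hT'occ hT'size using
      fun u => OccurFormula.exists_unitShift m₀ (G u)
    -- the touched children: "since `x_i` occurs in at most `k` of the `T_i`'s"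
    set U0 : Finset (Fin m) := Finset.univ.filter (fun u : Fin m => (G u).occur m₀ ≠ 0) with hU0
    have hcard : U0.card ≤ k := by
      have h1 := hocc m₀
      rw [OccurFormula.occur, hoccsum] at h1
      calc U0.card = ∑ u ∈ U0, 1 := by simp
        _ ≤ ∑ u ∈ U0, (G u).occur m₀ := Finset.sum_le_sum fun u hu =>
            Nat.one_le_iff_ne_zero.2 (Finset.mem_filter.1 hu).2
        _ ≤ ∑ u, (G u).occur m₀ :=
            Finset.sum_le_sum_of_subset_of_nonneg (Finset.filter_subset _ _) fun _ _ _ => Nat.zero_le _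
        _ ≤ k := h1
    set c : ℕ := U0.card with hc
    let e : Fin c ≃ U0 := U0.equivFin.symm
    -- the family `(T'_u)_{u ∈ U0} ∪ (T_u)_{u ∈ U0}` and its bounds
    let H : Fin (c + c) → OccurFormula F (multilinearMonomials n) :=
      Fin.append (fun j => T' (e j)) (fun j => G (e j))
    have hHocc : ∀ u i, (H u).occur i ≤ k := by
      intro u i
      refine Fin.addCases (fun j => ?_) (fun j => ?_) u
      · simp only [H, Fin.append_left]
        exact (hT'occ _ i).trans (hoccG _ i)
      · simp only [H, Fin.append_right]
        exact hoccG _ i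
    have hss : s ≤ s ^ 2 := by nlinarith
    have hHsize : ∀ u, (H u).size ≤ s ^ 2 := by
      intro u
      refine Fin.addCases (fun j => ?_) (fun j => ?_) u
      · simp only [H, Fin.append_left]
        exact (hT'size _).trans (Nat.pow_le_pow_left (hsizeG _) 2)
      · simp only [H, Fin.append_right]
        exact (hsizeG _).trans hss
    have hHdepth : ∀ u, (H u).depth ≤ D - 1 := by
      intro u
      refine Fin.addCases (fun j => ?_) (fun j => ?_) u
      · simp only [H, Fin.append_left]
        rw [hT'dep]
        exact hdepthG _
      · simp only [H, Fin.append_right]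
        exact hdepthG _
    -- `C̃ = H(T', T)` for `H = Σ_j X_j − Σ_j X'_j`
    set Q : MvPolynomial (Fin (c + c)) F :=
      (∑ j : Fin c, X (Fin.castAdd c j)) - ∑ j : Fin c, X (Fin.natAdd c j) with hQ
    have hQval : aeval (fun u => (H u).eval) Q = Δ := by
      rw [hQ, map_sub, map_sum, map_sum]
      simp only [aeval_X, H, Fin.append_left, Fin.append_right, hT'ev]
      rw [← Finset.sum_sub_distrib]
      have hsum : (∑ j : Fin c, (aeval (fun m : multilinearMonomials n =>
            if m = m₀ then X m + C 1 else (X m : MvPolynomial (multilinearMonomials n) F))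
              (G (e j)).eval - (G (e j)).eval)) =
          ∑ u ∈ U0, (aeval (fun m : multilinearMonomials n =>
            if m = m₀ then X m + C 1 else (X m : MvPolynomial (multilinearMonomials n) F))
              (G u).eval - (G u).eval) := by
        rw [← Finset.sum_coe_sort U0]
        exact Equiv.sum_comp e (fun u : U0 => aeval (fun m : multilinearMonomials n =>
            if m = m₀ then X m + C 1 else (X m : MvPolynomial (multilinearMonomials n) F))
              (G u).eval - (G u).eval)
      rw [hsum, hΔ, hC₀, hev, map_sum, ← Finset.sum_sub_distrib, hU0, Finset.sum_filter]
      refine Finset.sum_congr rfl fun u _ => ?_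
      split_ifs with hu
      · rfl
      · push Not at hu
        rw [aeval_unitShift_eq_self_of_notMem_vars
          (OccurFormula.notMem_vars_eval_of_occur_eq_zero m₀ (G u) hu), sub_self]
    -- faithfulness: the map does not kill `C̃`
    have hne : aeval (fun u => (H u).eval) Q ≠ 0 := by
      rw [hQval]
      exact hm₀
    have h2 := map_aeval_ne_zero_of_faithful
      (bind₁ (fun mm : multilinearMonomials n =>
        (∑ ℓ : Fin (D - 2), rename (fun v : Fin (r ℓ) ⊕ Unit =>
            (Sum.inl (ℓ, Sum.map (Fin.castLE (Nat.lt_succ_iff.mp (r ℓ).isLt)) id v) :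
              (Fin (D - 2) × (Fin Rslot ⊕ Unit)) ⊕ (Fin K₀ ⊕ (Fin K₀ × Fin n))))
          (vdmGenCoeff F n (r ℓ) (mm : Fin n →₀ ℕ))) +
          rename Sum.inr (svGenCoeff F n K₀ (mm : Fin n →₀ ℕ))))
      (fun u => (H u).eval)
      (fun Q' hQ' => (cor49_topFamilies_faithful hk hs hD hchar hK r hr (c + c) H (by omega)
        hHocc hHsize hHdepth Q').1 hQ') Q hne
    rw [hQval, hlayout K₀] at h2
    exact h2
  -- the extra SV block supplies the shift `α + e_{m₀}`
  have hshift : ∀ C' ∈ ({C₀} : Set (MvPolynomial (multilinearMonomials n) F)), C' ≠ 0 →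
      (∃ a : F, C' = C a) ∨ ∃ m₁ : multilinearMonomials n,
        aeval (fun m : multilinearMonomials n =>
            if m = m₁ then X m + C 1 else (X m : MvPolynomial (multilinearMonomials n) F)) C' - C' ∈
          ({Δ} : Set (MvPolynomial (multilinearMonomials n) F)) ∧
        aeval (fun m : multilinearMonomials n =>
            if m = m₁ then X m + C 1 else (X m : MvPolynomial (multilinearMonomials n) F)) C' - C' ≠ 0 := by
    intro C' hC' _
    rw [Set.mem_singleton_iff] at hC'
    rw [hC']
    exact Or.inr ⟨m₀, Set.mem_singleton _, hm₀⟩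
  exact (isHittingSetGenerator_svGenCoeff_succ_of_shift K₀ Gv {C₀} {Δ} hshift hgen) C₀
    (Set.mem_singleton C₀) h0

/-- **Cor. 49 pointwise, for every formula of the class** (`k ≥ 1`, `s ≥ 2`): a non-zero
polynomial computed by a depth-`≤ D` occur-`k` size-`≤ s` formula is not killed by
`Σ_ℓ Vdm_{r_ℓ} ⊕ G^{SV'}_{n,K₀+1}`. By induction on the depth: a leaf has at most `s ≤ 2^{K₀+1}`
monomials and is hit by the SV block alone (FSV Cor. 34; the Vandermonde seeds specialised to `0`);
a `×∧` gate is a product of powers of hit factors (a domain); a `+` gate is `cor49_addCase`.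
[cite: ForbesShpilkaVolk2018, Cor. 49 and Cor. 34 (seq.) = ToC Cor. 5.25, Cor. 5.10; AgrawalEtAl2011, §4 (¶1, Thm. dDkrPIT)]
locator: paper:arxiv-1701.05328 p0021.txt:L41–L50; paper:arxiv-1111.0582 p0009.txt:L3–L34 -/
theorem cor49_pointwise {D k s Rslot K₀ : ℕ} (hk : 1 ≤ k) (hs : 2 ≤ s)
    (hchar : ringChar F = 0 ∨ s ^ asssR k D < ringChar F) (hK : K₀ + 1 = asssK k D s)
    (r : Fin (D - 2) → Fin (Rslot + 1)) (hr : ∀ ℓ, (r ℓ : ℕ) = (asssRec k (2 * k) ℓ).1)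
    (φ : OccurFormula F (multilinearMonomials n)) (hdepth : φ.depth ≤ D)
    (hocc : ∀ i, φ.occur i ≤ k) (hsize : φ.size ≤ s) (h0 : φ.eval ≠ 0) :
    bind₁ (fun mm : multilinearMonomials n =>
        (∑ ℓ : Fin (D - 2),
          rename (fun v : Fin (r ℓ) ⊕ Unit =>
              (Sum.inl (ℓ, Sum.map (Fin.castLE (Nat.lt_succ_iff.mp (r ℓ).isLt)) id v) :
                (Fin (D - 2) × (Fin Rslot ⊕ Unit)) ⊕ (Fin (K₀ + 1) ⊕ (Fin (K₀ + 1) × Fin n))))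
            (vdmGenCoeff F n (r ℓ) (mm : Fin n →₀ ℕ))) +
          rename Sum.inr (svGenCoeff F n (K₀ + 1) (mm : Fin n →₀ ℕ))) φ.eval ≠ 0 := by
  classical
  suffices key : ∀ (d : ℕ) (φ : OccurFormula F (multilinearMonomials n)), φ.depth ≤ d →
      φ.depth ≤ D → (∀ i, φ.occur i ≤ k) → φ.size ≤ s → φ.eval ≠ 0 →
      bind₁ (fun mm : multilinearMonomials n =>
        (∑ ℓ : Fin (D - 2),
          rename (fun v : Fin (r ℓ) ⊕ Unit =>
              (Sum.inl (ℓ, Sum.map (Fin.castLE (Nat.lt_succ_iff.mp (r ℓ).isLt)) id v) :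
                (Fin (D - 2) × (Fin Rslot ⊕ Unit)) ⊕ (Fin (K₀ + 1) ⊕ (Fin (K₀ + 1) × Fin n))))
            (vdmGenCoeff F n (r ℓ) (mm : Fin n →₀ ℕ))) +
          rename Sum.inr (svGenCoeff F n (K₀ + 1) (mm : Fin n →₀ ℕ))) φ.eval ≠ 0 from
    key φ.depth φ le_rfl hdepth hocc hsize h0
  intro d
  induction d with
  | zero =>
    intro φ hd
    have := OccurFormula.one_le_depth φ
    omega
  | succ d ih =>
    intro φ hd hD hoccφ hsizeφ h0φ
    cases φ with
    | leaf p =>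
      -- a leaf: at most `s ≤ 2^{K₀+1}` monomials, hit by the SV block (Vandermonde seeds at `0`)
      rw [OccurFormula.eval] at h0φ ⊢
      rw [OccurFormula.size] at hsizeφ
      rw [OccurFormula.depth] at hD
      have hcard : p.support.card ≤ 2 ^ (K₀ + 1) :=
        ((card_support_le_leafSize p).trans hsizeφ).trans
          (by rw [hK]; exact (one_le_asssK_and_le_two_pow (s := s) hk (by omega)).2)
      have hsv := ForbesShpilkaVolk2018_svGeneratorHitsSparse_holds F n (K₀ + 1) p h0φ hcard
      refine bind₁_ne_zero_of_algHom_comp_eq p _ _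
        (aeval (Sum.elim (fun _ => (0 : MvPolynomial (Fin (K₀ + 1) ⊕ (Fin (K₀ + 1) × Fin n)) F))
          X)) (fun mm => ?_) hsv
      rw [map_add, map_sum, aeval_rename, Sum.elim_comp_inr, aeval_X_left_apply]
      have hzero : ∀ ℓ : Fin (D - 2),
          aeval (Sum.elim (fun _ => (0 : MvPolynomial (Fin (K₀ + 1) ⊕ (Fin (K₀ + 1) × Fin n)) F)) X)
            (rename (fun v : Fin (r ℓ) ⊕ Unit =>
              (Sum.inl (ℓ, Sum.map (Fin.castLE (Nat.lt_succ_iff.mp (r ℓ).isLt)) id v) :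
                (Fin (D - 2) × (Fin Rslot ⊕ Unit)) ⊕ (Fin (K₀ + 1) ⊕ (Fin (K₀ + 1) × Fin n))))
              (vdmGenCoeff F n (r ℓ) (mm : Fin n →₀ ℕ))) = 0 := by
        intro ℓ
        rw [aeval_rename, vdmGenCoeff, map_sum]
        refine Finset.sum_eq_zero fun j _ => ?_
        simp only [map_mul, map_pow, aeval_X, Function.comp_apply, Sum.elim_inl, zero_mul]
      rw [Finset.sum_eq_zero (fun ℓ _ => hzero ℓ), zero_add]
    | add as =>
      -- a `+` gate: the shift argument
      rw [OccurFormula.eval] at h0φ ⊢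
      exact cor49_addCase hk hs hchar hK r hr as hD hoccφ hsizeφ h0φ
    | powProd ps =>
      -- a `×∧` gate: a product of powers of hit factors
      rw [OccurFormula.eval] at h0φ ⊢
      rw [OccurFormula.depth] at hd hD
      obtain ⟨q, χ, e, hev, hoccv, hszv, hdpv⟩ := OccurPowArgs.exists_fin_view ps
      rw [hev] at h0φ ⊢
      rw [map_prod]
      refine Finset.prod_ne_zero_iff.2 fun i _ => ?_
      rw [map_pow]
      rcases Nat.eq_zero_or_pos (e i) with he | he
      · rw [he, pow_zero]
        exact one_ne_zero
      refine pow_ne_zero _ (ih (χ i) ?_ ?_ ?_ ?_ ?_)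
      · exact (hdpv i).trans (by omega)
      · exact (hdpv i).trans (by omega)
      · intro j
        have h1 := hoccφ j
        rw [OccurFormula.occur, hoccv] at h1
        exact (Finset.single_le_sum (f := fun v => (χ v).occur j) (fun _ _ => Nat.zero_le _)
          (Finset.mem_univ i)).trans h1
      · rw [OccurFormula.size, hszv] at hsizeφ
        have h1 := Finset.single_le_sum (f := fun v => e v + (χ v).size) (fun _ _ => Nat.zero_le _)
          (Finset.mem_univ i)
        omega
      · intro hzero
        apply h0φ
        exact Finset.prod_eq_zero (Finset.mem_univ i) (by rw [hzero, zero_pow he.ne'])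

end Assembly

end ASSS16

/-! ## Part 4. Cor. 49 in FSV Thm. 48's seed layout, then for `G^{ASSS}` itself (Prop. 17) -/

section Cor49

/-- **FSV Cor. 49 in the seed layout of FSV Thm. 48** (`D - 2` Vandermonde block slots of
`R = asssR k D` seeds, the shifted SV block with `R⌈log₂ s⌉ + R⌈log₂ R⌉` blocks): for some block
sizes `r_ℓ ≤ R` — namely the recursion values `r_{2+ℓ}` of [ASSS16] started at `t = 2k` — the map
`X_i ↦ Σ_ℓ Σ_{j ≤ r_ℓ} y_{j,ℓ} t_ℓ^{ij} + G^{SV'}(u,v)_i` is a hitting-set generator for ALL of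
`occurClass F (multilinearMonomials n) D k s`, assuming `char(𝔽) = 0` or `char(𝔽) > s^R`. Degenerate
parameters: `s ≤ 1` or `k = 0` (constants, `isHittingSetGenerator_occurClass_of_le_one`,
`OccurFormula.exists_eval_eq_C_of_occur_eq_zero`), `D = 0` (empty class); otherwise
`ASSS16.cor49_pointwise`. [cite: ForbesShpilkaVolk2018, Thm. 48 and Cor. 49 (seq.) = ToC Thm. 5.24, Cor. 5.25; AgrawalEtAl2011, §4]
locator: paper:arxiv-1701.05328 p0021.txt:L31–L50; paper:arxiv-1111.0582 p0009.txt:L3–p0010.txt:L62 -/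
theorem FSV2018_cor49_vdmLayout (F : Type) [Field F] (n D k s : ℕ)
    (hchar : ringChar F = 0 ∨ s ^ asssR k D < ringChar F) :
    ∃ r : Fin (D - 2) → Fin (asssR k D + 1),
      IsHittingSetGenerator (occurClass F (multilinearMonomials n) D k s)
        (fun m : multilinearMonomials n =>
          (∑ ℓ : Fin (D - 2),
            rename (fun v : Fin (r ℓ) ⊕ Unit =>
                (Sum.inl (ℓ, Sum.map (Fin.castLE (Nat.lt_succ_iff.mp (r ℓ).isLt)) id v) :
                  (Fin (D - 2) × (Fin (asssR k D) ⊕ Unit)) ⊕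
                    (Fin (asssK k D s) ⊕ (Fin (asssK k D s) × Fin n))))
              (vdmGenCoeff F n (r ℓ) (m : Fin n →₀ ℕ))) +
            rename Sum.inr (svGenCoeff F n (asssK k D s) (m : Fin n →₀ ℕ))) := by
  classical
  -- `s ≤ 1`: the class consists of constants
  rcases Nat.lt_or_ge s 2 with hs | hs
  · exact ⟨fun _ => ⟨0, Nat.succ_pos _⟩, isHittingSetGenerator_occurClass_of_le_one _ (by omega)⟩
  -- `k = 0`: the class consists of constants
  rcases Nat.eq_zero_or_pos k with hk0 | hk
  · subst hk0
    refine ⟨fun _ => ⟨0, Nat.succ_pos _⟩, fun P hP hP0 => ?_⟩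
    obtain ⟨φ, hφ, -, hocc, -⟩ := hP
    obtain ⟨c, hc⟩ := OccurFormula.exists_eval_eq_C_of_occur_eq_zero φ fun i => Nat.le_zero.1 (hocc i)
    rw [← hφ, hc, bind₁_C_right, Ne, C_eq_zero]
    intro h
    apply hP0
    rw [← hφ, hc, h, C_0]
  -- `D = 0`: the class is empty (every formula has depth `≥ 1`)
  rcases Nat.eq_zero_or_pos D with hD0 | hD
  · subst hD0
    refine ⟨fun _ => ⟨0, Nat.succ_pos _⟩, fun P hP _ => ?_⟩
    obtain ⟨φ, -, hd, -, -⟩ := hP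
    have := OccurFormula.one_le_depth φ
    omega
  -- the main case: block sizes `r_{2+ℓ}` of the recursion started at `t = 2k`
  have hK1 := (ASSS16.one_le_asssK_and_le_two_pow (s := s) hk hD).1
  obtain ⟨K₀, hK⟩ : ∃ K₀, asssK k D s = K₀ + 1 := ⟨asssK k D s - 1, by omega⟩
  rw [hK]
  refine ⟨fun ℓ => ⟨(asssRec k (2 * k) ℓ).1,
    Nat.lt_succ_of_le (ASSS16.asssRec_double_le_asssR hk (by have := ℓ.2; omega))⟩, ?_⟩
  intro P hP hP0
  obtain ⟨φ, rfl, hd, hocc, hsz⟩ := hP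
  exact ASSS16.cor49_pointwise hk hs hchar hK.symm _ (fun ℓ => rfl) φ hd hocc hsz hP0

variable {F : Type*} [Field F] {n : ℕ}

/-- `rename` as a `bind₁` (plumbing). [folklore] -/
private theorem rename_eq_bind₁_X' {σ τ R : Type*} [CommSemiring R] (g : σ → τ)
    (p : MvPolynomial σ R) : rename g p = bind₁ (fun i => (X (g i) : MvPolynomial τ R)) p := by
  induction p using MvPolynomial.induction_on with
  | C a => simp
  | add p q hp hq => simp [hp, hq]
  | mul_X p i hp => simp [hp]

/-- Truncating a Vandermonde block: zeroing the `y_j` with `j ≥ r'` in `∑_{j<r} y_j t^{ij}` leaves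
`∑_{j<r'} y_j t^{ij}` ("by possibly restricting excess `y_ℓ` variables to `0`", proof of Cor. 49; the
same computation as in `FSV18OccurReductions.lean`, whose copy is private there).
[cite: ForbesShpilkaVolk2018, Cor. 49 (seq.) = ToC Cor. 5.25, p. 30 (proof)] -/
private theorem bind₁_truncSubst_vdmGenCoeff' {r' r : ℕ} (h : r' ≤ r) (m : Fin n →₀ ℕ) :
    bind₁ (Sum.elim (fun j : Fin r => if h : (j : ℕ) < r' then
          (X (Sum.inl ⟨j, h⟩) : MvPolynomial (Fin (r') ⊕ Unit) F) else 0)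
        fun u => X (Sum.inr u))
      (vdmGenCoeff F n r m) = vdmGenCoeff F n r' m := by
  let f : ℕ → MvPolynomial (Fin r' ⊕ Unit) F := fun j =>
    (if h : j < r' then (X (Sum.inl ⟨j, h⟩) : MvPolynomial (Fin r' ⊕ Unit) F) else 0) *
      X (Sum.inr ()) ^ ((j + 1) * binIndex m)
  have hl : bind₁ (Sum.elim (fun j : Fin r => if h : (j : ℕ) < r' then
          (X (Sum.inl ⟨j, h⟩) : MvPolynomial (Fin (r') ⊕ Unit) F) else 0)
        fun u => X (Sum.inr u))
      (vdmGenCoeff F n r m) = ∑ j : Fin r, f j := by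
    rw [vdmGenCoeff, map_sum]
    refine Finset.sum_congr rfl fun j _ => ?_
    rw [map_mul, map_pow, bind₁_X_right, bind₁_X_right]
    rfl
  have hr : vdmGenCoeff F n r' m = ∑ j : Fin r', f j := by
    rw [vdmGenCoeff]
    refine Finset.sum_congr rfl fun j _ => ?_
    simp only [f, dif_pos j.2, Fin.eta]
  rw [hl, hr, Fin.sum_univ_eq_sum_range f r, Fin.sum_univ_eq_sum_range f r']
  symm
  refine Finset.sum_subset (Finset.range_subset_range.2 h) fun j _ hj' => ?_
  have hjr' : ¬ j < r' := fun h' => hj' (Finset.mem_range.2 h')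
  simp only [f, dif_neg hjr', zero_mul]

/-- **`FSV2018_cor49` — the named fact DISCHARGED** (FSV Cor. 49 = ToC Cor. 5.25 AS TYPED: for
every field of characteristic `0` or `> s^R`, `R = (2k)^{2D·2^D}`, and all `n, D, k, s`, the generator
`G^{ASSS}` of Construction 46 hits every non-zero polynomial of `occurClass F (multilinearMonomials n)
D k s`). From `FSV2018_cor49_vdmLayout` exactly as Cor. 49 is derived from Thm. 48 in print:
"by Proposition 17 [`t_0 ↦ t`, `t_i ↦ t^{2^{i-1}}`, `bind₁_binaryPowersSubst_rcGenCoeff`], possibly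
restricting excess `y_ℓ` variables to `0`", `G^{ASSS}` specialises to the Vandermonde layout, so
`P ∘ G^{ASSS} = 0` would force `P ∘ Ψ_r = 0`. [cite: ForbesShpilkaVolk2018, Cor. 49 (seq.) = ToC Cor. 5.25, p. 30; AgrawalEtAl2011, §4 (Thm. dDkrPIT)]
locator: paper:arxiv-1701.05328 p0021.txt:L41–L50 -/
theorem FSV2018_cor49_holds : FSV2018_cor49 := by
  intro F _ n D k s hchar
  obtain ⟨r, hr⟩ := FSV2018_cor49_vdmLayout F n D k s hchar
  intro P hP hP0 hzero
  refine hr P hP hP0 ?_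
  -- the seed slots of block `ℓ`'s truncated Vandermonde map inside `Ψ_r`'s seed type
  let ιℓ : (ℓ : Fin (D - 2)) → Fin (r ℓ) ⊕ Unit →
      (Fin (D - 2) × (Fin (asssR k D) ⊕ Unit)) ⊕
        (Fin (asssK k D s) ⊕ (Fin (asssK k D s) × Fin n)) :=
    fun ℓ v => Sum.inl (ℓ, Sum.map (Fin.castLE (Nat.lt_succ_iff.mp (r ℓ).isLt)) id v)
  -- the substitution: binary powers of `t_ℓ` for the `t`-seeds (Prop. 17), excess `y`'s to `0`,
  -- SV seeds kept
  let θ : (Fin (D - 2) × (Fin (asssR k D) ⊕ Fin (n + 1))) ⊕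
      (Fin (asssK k D s) ⊕ (Fin (asssK k D s) × Fin n)) →
      MvPolynomial ((Fin (D - 2) × (Fin (asssR k D) ⊕ Unit)) ⊕
        (Fin (asssK k D s) ⊕ (Fin (asssK k D s) × Fin n))) F :=
    Sum.elim
      (fun p => rename (ιℓ p.1)
        (bind₁ (Sum.elim (fun j : Fin (asssR k D) => if h : (j : ℕ) < r p.1 then
              (X (Sum.inl ⟨j, h⟩) : MvPolynomial (Fin (r p.1) ⊕ Unit) F) else 0)
            fun u => X (Sum.inr u))
          (binaryPowersSubst F n (asssR k D) p.2)))
      fun v => X (Sum.inr v)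
  have hθ : ∀ m : multilinearMonomials n,
      (∑ ℓ : Fin (D - 2), rename (ιℓ ℓ) (vdmGenCoeff F n (r ℓ) (m : Fin n →₀ ℕ))) +
        rename Sum.inr (svGenCoeff F n (asssK k D s) (m : Fin n →₀ ℕ)) =
      bind₁ θ (asssGenCoeff F D k n s (m : Fin n →₀ ℕ)) := by
    intro m
    rw [asssGenCoeff, map_add, map_sum]
    congr 1
    · refine Finset.sum_congr rfl fun ℓ _ => ?_
      rw [bind₁_rename]
      show _ = bind₁ (fun v => rename (ιℓ ℓ) (bind₁
        (Sum.elim (fun j : Fin (asssR k D) => if h : (j : ℕ) < r ℓ then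
              (X (Sum.inl ⟨j, h⟩) : MvPolynomial (Fin (r ℓ) ⊕ Unit) F) else 0)
            fun u => X (Sum.inr u))
        (binaryPowersSubst F n (asssR k D) v))) _
      rw [← rename_bind₁, ← bind₁_bind₁, bind₁_binaryPowersSubst_rcGenCoeff,
        bind₁_truncSubst_vdmGenCoeff' (Nat.lt_succ_iff.mp (r ℓ).isLt)]
    · rw [bind₁_rename]
      show _ = bind₁ (fun v => X (Sum.inr v)) _
      rw [← rename_eq_bind₁_X']
  show bind₁ (fun m : multilinearMonomials n =>
      (∑ ℓ : Fin (D - 2), rename (ιℓ ℓ) (vdmGenCoeff F n (r ℓ) (m : Fin n →₀ ℕ))) +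
        rename Sum.inr (svGenCoeff F n (asssK k D s) (m : Fin n →₀ ℕ))) P = 0
  rw [funext hθ, ← bind₁_bind₁, hzero, map_zero]

end Cor49

end Literature.Computability.AlgebraicComplexity

end
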